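import Mathlib
import Literature.NumberTheory.Transcendental.KZCalculus
import Summits.KontsevichZagierPeriods.KontsevichZagierPeriods.Theses.UnfoldedStokes

/-!
# Sketch — crux-ideate round 1 (ideator 2) for `ContinuousCubification` (stmt-KontsevichZagierPeriods-17853)

First lemmas of two idea cards, stated over existing declarations (not proved here):

* idea `generic-xray-slicing`: `continuous_xray_of_frontier_subset`, `exists_ratShear_finite_fibres`,
  `exists_xrayRep_sub_mem_relations`;
* idea `grounded-radial-chart`: `continuousOn_radialFun_of_downset`, `det_radialChart_columns`.

Both feed the common residual `VolumeC0Cubification` (one bounded unit solid), which implies the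
crux by the free-abelian-group induction of the landed `stub_cubifyKernel` (refuter's kernel-checked
`cc_iff_compactVolumeCubification`, evidence Scratch.lean on the item).
-/

noncomputable section

open MeasureTheory Set
open Literature.NumberTheory.Transcendental
open Literature.NumberTheory.Transcendental.KZ
open Summit.KontsevichZagierPeriods.KontsevichZagierPeriods.Theses.UnfoldedStokes (ContinuousCubification)

namespace Summit.KontsevichZagierPeriods.KontsevichZagierPeriods.Cruxes.ContinuousCubification.IdeasR1K2

/-- Common residual of both cards: ONE bounded unit-integrand solid is congruent modulo the moves
to a closed-cube representation with integrand continuous on the closed cube. -/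
def VolumeC0Cubification : Prop :=
  ∀ (d : ℕ) (V : IntegralRep d), Bornology.IsBounded V.domain → (∀ z ∈ V.domain, V.integrand z = 1) →
    ∃ (M : ℕ) (t : IntegralRep M), t.domain = Set.pi Set.univ (fun _ : Fin M => Set.Icc (0:ℝ) 1) ∧
      ContinuousOn t.integrand t.domain ∧ of V - of t ∈ relations

/-- The residual implies the crux (free-abelian induction of `stub_cubifyKernel` with "continuous"
in place of "bounded": `0`, negation, sums via Newton–Leibniz slabs `f ∘ Fin.init`, invariance
under `relations`, and `[r] ≡ [A] − [B]` with bounded unit solids, `KZ.exists_sub_of_isBounded`). -/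
theorem continuousCubification_of_volume (h : VolumeC0Cubification) : ContinuousCubification := by
  sorry

/-! ## Idea 1 — generic-direction X-ray (tilted Cavalieri slicing) -/

/-- FIRST LEMMA (analytic core, pure measure theory): if the frontier of a bounded measurable
`A ⊆ ℝ^{m+1}` lies in a set `N` all of whose vertical fibres are Lebesgue-null ("no vertical
walls"), then the parallel X-ray `x ↦ λ¹(A_x)` along the last coordinate is continuous on all of
`ℝ^m`. Proof: off `N_x` the indicator `1_A` is locally constant at `(x,t)` (interior or exterior
point), so `1_A(x', ·) → 1_A(x, ·)` a.e. as `x' → x`; dominated convergence on a bounded fibre. -/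
theorem continuous_xray_of_frontier_subset {m : ℕ} {A N : Set (Fin (m + 1) → ℝ)}
    (hA : MeasurableSet A) (hb : Bornology.IsBounded A) (hfr : frontier A ⊆ N)
    (hfib : ∀ x : Fin m → ℝ, volume {t : ℝ | (Fin.snoc x t : Fin (m + 1) → ℝ) ∈ N} = 0) :
    Continuous fun x : Fin m → ℝ =>
      (volume {t : ℝ | (Fin.snoc x t : Fin (m + 1) → ℝ) ∈ A}).toReal := by
  sorry

/-- Genericity (Basu–Pollack–Roy 2006, Lemma 4.73, with RATIONAL parameters): for a non-zero
polynomial `P` over `ℚ` in `m + 1` variables there is a rational shear direction `c` such that on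
every vertical line of the sheared coordinates `P` has only finitely many zeros (the sheared
polynomial `P(x' − t c, t)` is quasi-monic in `t`: its `t`-leading coefficient is the top
homogeneous component of `P` at `(−c, 1)`, non-zero for `c` off a proper algebraic subset of `ℚ^m`). -/
theorem exists_ratShear_finite_fibres {m : ℕ} (P : MvPolynomial (Fin (m + 1)) ℚ) (hP : P ≠ 0) :
    ∃ c : Fin m → ℚ, ∀ x : Fin m → ℝ,
      {t : ℝ | MvPolynomial.aeval
        (Fin.snoc (x - t • (fun i => (c i : ℝ))) t : Fin (m + 1) → ℝ) P = 0}.Finite := by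
  sorry

/-- The move (tree technology: `KZ.of_sub_of_mem_relations_cell` / `…_groundLast` stop one step
early): a bounded unit solid `V ⊆ (−R, R)^{m+1}` is congruent modulo the moves to the box
`[−R, R]^m` carrying its X-ray along the last coordinate as integrand — cylindrical decomposition
adapted to `V` (proved in tree), rule (1a) along the cylinders and null cells, rule (3) with
primitive `t` on each closed band, rule (1b) summing the band widths over each base cell into the
fibre length (`KZ.volume_fibre_eq_ofReal_sum`), rule (1a) gluing the base cells and the
zero-integrand complement into the box. -/
theorem exists_xrayRep_sub_mem_relations {m : ℕ} (V : IntegralRep (m + 1))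
    (h1 : ∀ z ∈ V.domain, V.integrand z = 1) (R : ℚ) (hR : ∀ z ∈ V.domain, ∀ i, |z i| < R) :
    ∃ X : IntegralRep m, X.domain = Set.pi Set.univ (fun _ : Fin m => Set.Icc (-(R : ℝ)) R) ∧
      (∀ x ∈ X.domain, X.integrand x =
        (volume {t : ℝ | (Fin.snoc x t : Fin (m + 1) → ℝ) ∈ V.domain}).toReal) ∧
      of V - of X ∈ relations := by
  sorry

/-! ## Idea 2 — radial chart of the grounded down-set -/

/-- Radial function of a set with respect to the origin (Gardner 2006, (0.28), non-negative
multiples, closure taken so that the null frontier is immaterial). -/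
def radialFun {N : ℕ} (D : Set (Fin N → ℝ)) (u : Fin N → ℝ) : ℝ :=
  sSup {s : ℝ | 0 ≤ s ∧ s • u ∈ closure D}

/-- FIRST LEMMA (geometric core): the radial function of a bounded non-empty down-set of the open
positive orthant — exactly the output of the landed `KZ.exists_downset_sub_mem_relations` — is
continuous on the CLOSED simplex of directions `{u ≥ 0, ∑ uᵢ = 1}` (upper semicontinuity from
compactness of the closure; lower semicontinuity because below any point of `D` the whole open box
lies in `D`, including near directions with vanishing coordinates). -/
theorem continuousOn_radialFun_of_downset {N : ℕ} {D : Set (Fin N → ℝ)}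
    (hpos : ∀ x ∈ D, ∀ i, 0 < x i)
    (hdown : ∀ x ∈ D, ∀ y : Fin N → ℝ, (∀ i, 0 < y i ∧ y i ≤ x i) → y ∈ D)
    (hb : Bornology.IsBounded D) (hne : D.Nonempty) :
    ContinuousOn (radialFun D) {u | (∀ i, 0 ≤ u i) ∧ ∑ i, u i = 1} := by
  sorry

/-- The derivative-free Jacobian of the radial chart `Ψ(τ, s) = s · ρ(τ) · σ(τ)`: its columns are
`∂_{τ_k} Ψ = s (∂_k ρ) σ + s ρ ∂_k σ` (`k < n`) and `∂_s Ψ = ρ σ`; every term containing a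
derivative `g k = ∂_k ρ` is proportional to the last column and dies, so
`det DΨ = sⁿ ρⁿ⁺¹ det[∂σ | σ]` — the gradient `g` of the radial function does NOT occur. -/
theorem det_radialChart_columns {n : ℕ} (ρ s : ℝ) (g : Fin n → ℝ) (σ : Fin (n + 1) → ℝ)
    (Dσ : Matrix (Fin (n + 1)) (Fin n) ℝ) :
    Matrix.det (Matrix.of fun i j =>
        Fin.lastCases (ρ * σ i) (fun k : Fin n => s * g k * σ i + s * ρ * Dσ i k) j)
      = s ^ n * ρ ^ (n + 1) *
        Matrix.det (Matrix.of fun i j => Fin.lastCases (σ i) (fun k : Fin n => Dσ i k) j) := by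
  sorry

end Summit.KontsevichZagierPeriods.KontsevichZagierPeriods.Cruxes.ContinuousCubification.IdeasR1K2

end
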